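import Summits.HodgeConjecture.CorCM.Census.CyclicCharacterCyclicSylowLaw

/-!
# Cyclic characters, XXIV: EVEN KERNEL — the ties of the bottom walk, their two nearest arc types, and linearisation from an explicit face

COR-CM (cell `pub-hodgecm2`), count-neutral kernel combinatorics by the binder seat b09 (gen 43; lane CYCLIC-CHARACTER FIBRE LAW, part XXIV), on parts
XVII (`Census/CyclicCharacterNearLinearisation.lean`), XX, XXI BY NAME.  Theorems only (no definition, no `decide`, no certificate, no named fact, no `sorry`).
HONEST FRAMING: `HC_CM` is NOT proved, here or anywhere in the tree; nothing here is a period or a headline.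

THE PROBLEM.  Parts XIX–XXIII settle the class «`w ↠ ℤ/2ᵏ`, `w c ≠ 0`» when the kernel `F_0 = ker w` has ODD size `2m + 1`: then every type of the bottom
walk `T_0 → T_1` is strictly nearer to one of `T_0`, `T_1`, and the closing faces linearise through ANY cover (parts XVII/XX).  When `|F_0| = 2m` is EVEN the
types `X_C = T_0` flipped at `m` bottom places (`T_0 ∖ X_C = C`, `|C| = m`) are TIES — at distance `m` from `T_0` AND from `T_1` — and the reduction an
abstract cover performs at a tie is not determined.  This file supplies what survives:

* §1 **TIES**: a tie is at distance `≥ m` from every arc type (`card_sdiff_le_ddist_of_tie`), its potential is `m` (`bpot_eq_of_tie`), and **an arc type at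
  distance exactly `m` from a tie is `T_0` or `T_1`** (`rt_arcType_eq_zero_or_one_of_tie`: equality in the triangle inequality fills the fibre `F_0`, and the
  point `g₁` with `w g₁ = 1` pins `w Q = −1`).  So the toward face of ANY cover at a tie points to `T_0` («down») or to `T_1` («up») — nothing else.
* §2 **LINEARISATION FROM AN EXPLICIT FACE** (`single_sub_normalForm_mem_of_face`): if `L` (with the toward property) contains a face `gface Φ b b'` flipping two
  deviation places of `Φ` from the arc type `T = T_0·Q₀⁻¹` and `2·ddist T Φ ≤ |F_0|`, then `[Φ] ≡ [T] + Σ_{t ∈ T∖Φ} ([T^{(t)}] − [T]) (mod L)` — the three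
  lower corners are within half a fibre of `T` (part XVII) and the face closes the induction step.  With §1 every tie is linearised, down or up, by the face
  its cover happens to hold; and the alternating-sum glue `alt_normalForm_mem_of_mems` (part XVIIʼs §4 with the four linearisations as hypotheses).
Part XXV (`Census/CyclicCharacterEvenEquator.lean`) turns these into the even equator relations and part XXVI into the law for even kernels with `d = 1`.

## References
* [Pohlmann1968] H. Pohlmann, Algebraic cycles on abelian varieties of complex multiplication type, Ann. of Math. 88 (1968), Thm 1.
* [Milne1999] J. S. Milne, Lefschetz motives and the Tate conjecture, Compositio Math. 117 (1999), Prop. 2.1, p. 54.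
-/

namespace Summit.HodgeConjecture.CorCM.Census.CyclicCharacter

open Finset
open Summit.HodgeConjecture.CorCM.Prior.AllgGroup.RfwfAllgGroup
open Summit.HodgeConjecture.CorCM.Census.BlockParity
open Summit.HodgeConjecture.CorCM.Census.Coinvariant
open Summit.HodgeConjecture.CorCM.Census.TwistGeneration
open Summit.HodgeConjecture.CorCM.Census.Nondegenerate
open Summit.HodgeConjecture.CorCM.Census.BaseBlock

noncomputable section

variable {G : Type*} [Group G] [Fintype G] [DecidableEq G] {k : ℕ} {w : G → ZMod (2 ^ k)} {c : G}

/-! ## §1 Ties: distance `m` from `T_0` with `2m = |F_0|` -/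

/-- **A tie is at distance at least `|T_0 ∖ X|` from every arc type**: if `2|T_0 ∖ X| = |F_0|` then `|T_0 ∖ X| ≤ ddist (T_0·Q⁻¹) X` for every `Q`
(two distinct arc types are a whole fibre apart, part XVII). [folklore] -/
theorem card_sdiff_le_ddist_of_tie (hw : ∀ P Q : G, w (P * Q) = w P + w Q) (hk : 1 ≤ k) (hc2 : c * c = 1) (hwc : w c ≠ 0) {X : CMF G c}
    (h2 : 2 * ((arcType hw hk hc2 hwc 0).1 \ X.1).card = (univ.filter fun s : G => w s = 0).card) (Q : G) :
    ((arcType hw hk hc2 hwc 0).1 \ X.1).card ≤ ddist (rt c Q (arcType hw hk hc2 hwc 0)) X := by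
  by_cases hQ : rt c Q (arcType hw hk hc2 hwc 0) = arcType hw hk hc2 hwc 0
  · rw [hQ]; unfold ddist; exact le_rfl
  · have hfar := card_ker_le_ddist_arcType_rt hw hk hc2 hwc hQ
    have htri := ddist_triangle (arcType hw hk hc2 hwc 0) X (rt c Q (arcType hw hk hc2 hwc 0))
    rw [ddist_comm hc2 X] at htri
    unfold ddist at hfar htri ⊢
    omega

/-- **The potential of a tie is `|T_0 ∖ X|`.** [folklore] -/
theorem bpot_eq_of_tie (hw : ∀ P Q : G, w (P * Q) = w P + w Q) (hk : 1 ≤ k) (hc2 : c * c = 1) (hwc : w c ≠ 0) {X : CMF G c}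
    (h2 : 2 * ((arcType hw hk hc2 hwc 0).1 \ X.1).card = (univ.filter fun s : G => w s = 0).card) :
    bpot c (arcType hw hk hc2 hwc 0) X = ((arcType hw hk hc2 hwc 0).1 \ X.1).card := by
  apply le_antisymm
  · have h := bpot_le c (arcType hw hk hc2 hwc 0) X 1
    rw [rt_one] at h
    exact h
  · obtain ⟨Q, hQ⟩ := exists_bpot_eq c (arcType hw hk hc2 hwc 0) X
    rw [hQ]
    exact card_sdiff_le_ddist_of_tie hw hk hc2 hwc h2 Q

/-- **THE TWO NEAREST ARC TYPES OF A TIE.**  If `T_0 ∖ X ⊆ F_0` is non-empty, `2|T_0 ∖ X| = |F_0|`, and the arc type `T_0·Q⁻¹` is at distance exactly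
`|T_0 ∖ X|` from `X`, then `T_0·Q⁻¹ = T_0` or `T_0·Q⁻¹ = T_1` (`k ≥ 2`, `w` onto).  Equality in the triangle inequality puts the whole fibre `F_0` into
`T_0 ∖ T_0·Q⁻¹`, which then has no room for the point `g₁` (`w g₁ = 1`): so `(w Q).val ≥ 2ᵏ⁻¹ > (1 + w Q).val`, i.e. `w Q = −1`. [folklore] -/
theorem rt_arcType_eq_zero_or_one_of_tie (hw : ∀ P Q : G, w (P * Q) = w P + w Q) (hk : 1 ≤ k) (hk2 : 2 ≤ k) (hc2 : c * c = 1) (hwc : w c ≠ 0)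
    (h1 : ∃ g₁ : G, w g₁ = 1) {X : CMF G c} (hX : (arcType hw hk hc2 hwc 0).1 \ X.1 ⊆ univ.filter fun s : G => w s = 0)
    (h2 : 2 * ((arcType hw hk hc2 hwc 0).1 \ X.1).card = (univ.filter fun s : G => w s = 0).card)
    (hne : ((arcType hw hk hc2 hwc 0).1 \ X.1).Nonempty) {Q : G}
    (hQ : ddist (rt c Q (arcType hw hk hc2 hwc 0)) X = ((arcType hw hk hc2 hwc 0).1 \ X.1).card) :
    rt c Q (arcType hw hk hc2 hwc 0) = arcType hw hk hc2 hwc 0 ∨ rt c Q (arcType hw hk hc2 hwc 0) = arcType hw hk hc2 hwc 1 := by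
  haveI : NeZero (2 ^ k) := ⟨pow_ne_zero _ two_ne_zero⟩
  haveI : Fact (1 < 2 ^ k) := ⟨Nat.one_lt_two_pow (by omega)⟩
  by_cases hQ0 : rt c Q (arcType hw hk hc2 hwc 0) = arcType hw hk hc2 hwc 0
  · exact Or.inl hQ0
  right
  have hfar := card_ker_le_ddist_arcType_rt hw hk hc2 hwc hQ0
  -- `T_0 ∖ T' ⊆ (T_0 ∖ X) ∪ (X ∖ T')`, both of size `m`
  have hsub : (arcType hw hk hc2 hwc 0).1 \ (rt c Q (arcType hw hk hc2 hwc 0)).1 ⊆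
      ((arcType hw hk hc2 hwc 0).1 \ X.1) ∪ (X.1 \ (rt c Q (arcType hw hk hc2 hwc 0)).1) := by
    intro x hx
    rw [mem_sdiff] at hx
    rw [mem_union, mem_sdiff, mem_sdiff]
    by_cases hxX : x ∈ X.1
    · exact Or.inr ⟨hxX, hx.2⟩
    · exact Or.inl ⟨hx.1, hxX⟩
  have hXT : (X.1 \ (rt c Q (arcType hw hk hc2 hwc 0)).1).card = ((arcType hw hk hc2 hwc 0).1 \ X.1).card := by
    have h := hQ
    rw [ddist_comm hc2] at h
    exact h
  have hucard := card_union_le ((arcType hw hk hc2 hwc 0).1 \ X.1) (X.1 \ (rt c Q (arcType hw hk hc2 hwc 0)).1)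
  have hcardT' : ((arcType hw hk hc2 hwc 0).1 \ (rt c Q (arcType hw hk hc2 hwc 0)).1).card = (univ.filter fun s : G => w s = 0).card := by
    have := card_le_card hsub
    unfold ddist at hfar
    omega
  have heq : (arcType hw hk hc2 hwc 0).1 \ (rt c Q (arcType hw hk hc2 hwc 0)).1 =
      ((arcType hw hk hc2 hwc 0).1 \ X.1) ∪ (X.1 \ (rt c Q (arcType hw hk hc2 hwc 0)).1) :=
    eq_of_subset_of_card_le hsub (by omega)
  -- a bottom point `s` of the tie lies in `T_0 ∖ T'`, hence so does its whole fibre, which fills `T_0 ∖ T'`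
  obtain ⟨s, hs⟩ := hne
  have hs0 : w s = 0 := (mem_filter.mp (hX hs)).2
  have hsT' : s ∈ (arcType hw hk hc2 hwc 0).1 \ (rt c Q (arcType hw hk hc2 hwc 0)).1 := by rw [heq]; exact mem_union_left _ hs
  have himg : ((univ.filter fun n : G => w n = 0).image fun n => s * n) ⊆ (arcType hw hk hc2 hwc 0).1 \ (rt c Q (arcType hw hk hc2 hwc 0)).1 := by
    intro x hx
    obtain ⟨n, hn, rfl⟩ := mem_image.mp hx
    exact mul_mem_sdiff_rt_arcType hw hk hc2 hwc Q hsT' (mem_filter.mp hn).2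
  have himg_eq : ((univ.filter fun n : G => w n = 0).image fun n => s * n) = (arcType hw hk hc2 hwc 0).1 \ (rt c Q (arcType hw hk hc2 hwc 0)).1 :=
    eq_of_subset_of_card_le himg (by rw [card_image_of_injective _ (mul_right_injective s), hcardT'])
  -- the point `g₁` lies in `T_0` but not in `T_0 ∖ T'`
  obtain ⟨g₁, hg₁⟩ := h1
  have hg₁T : g₁ ∈ (arcType hw hk hc2 hwc 0).1 :=
    (mem_arcType_of_apply_eq_natCast hw hk hc2 hwc (j := 1) (by rw [hg₁, Nat.cast_one])
      (Nat.one_lt_two_pow (by omega))).1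
  have hg₁T' : g₁ ∈ (rt c Q (arcType hw hk hc2 hwc 0)).1 := by
    by_contra h
    have hmem : g₁ ∈ (arcType hw hk hc2 hwc 0).1 \ (rt c Q (arcType hw hk hc2 hwc 0)).1 := mem_sdiff.mpr ⟨hg₁T, h⟩
    rw [← himg_eq] at hmem
    obtain ⟨n, hn, hn'⟩ := mem_image.mp hmem
    have e := congrArg w hn'
    rw [hw, hs0, (mem_filter.mp hn).2, add_zero, hg₁] at e
    exact one_ne_zero e.symm
  -- read off `w Q = -1`
  have hv1 : ¬ (w Q).val < 2 ^ (k - 1) := by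
    have h := (mem_sdiff.mp hsT').2
    rwa [rt_arcType, mem_arcType, hs0, zero_sub, zero_sub, neg_neg] at h
  have hv2 : (1 + w Q).val < 2 ^ (k - 1) := by
    have h := hg₁T'
    rwa [rt_arcType, mem_arcType, hg₁, zero_sub, sub_neg_eq_add] at h
  have hwQ : w Q = -1 := by
    by_contra hne'
    have hu : 1 + w Q ≠ 0 := fun h => hne' (eq_neg_of_add_eq_zero_right h)
    have h1le : (1 : ZMod (2 ^ k)).val ≤ (1 + w Q).val := by
      rw [ZMod.val_one]
      exact Nat.one_le_iff_ne_zero.mpr fun h => hu ((ZMod.val_eq_zero _).mp h)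
    have hvs := ZMod.val_sub h1le
    rw [add_sub_cancel_left, ZMod.val_one] at hvs
    omega
  rw [rt_arcType, hwQ, zero_sub, neg_neg]

/-! ## §2 Linearisation from an explicit face; the alternating-sum glue -/

/-- **LINEARISATION FROM AN EXPLICIT FACE.**  Let `L` have the toward property, `T = T_0·Q₀⁻¹`, `2·ddist T Φ ≤ |F_0|`, and let `L` contain a face
`gface Φ b b'` at two distinct deviation places `b ≠ b' ∈ T ∖ Φ`.  Then `[Φ] − ([T] + Σ_{t ∈ T∖Φ} ([T^{(t)}] − [T])) ∈ L`: the three lower corners are within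
half a fibre of `T` (part XVII linearises them) and the face supplies the top step.  At a TIE this is the linearisation the coverʼs own face decides. [folklore] -/
theorem single_sub_normalForm_mem_of_face (hw : ∀ P Q : G, w (P * Q) = w P + w Q) (hk : 1 ≤ k) (hc2 : c * c = 1) (hwc : w c ≠ 0)
    (L : Submodule ℤ (CMF G c →₀ ℤ))
    (htw : ∀ Φ : CMF G c, 2 ≤ bpot c (arcType hw hk hc2 hwc 0) Φ → ∃ Q t t' : G,
      bpot c (arcType hw hk hc2 hwc 0) Φ = ddist (rt c Q (arcType hw hk hc2 hwc 0)) Φ ∧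
        t ∈ (rt c Q (arcType hw hk hc2 hwc 0)).1 \ Φ.1 ∧ t' ∈ (rt c Q (arcType hw hk hc2 hwc 0)).1 \ Φ.1 ∧ t ≠ t' ∧ gface c hc2 Φ t t' ∈ L)
    (Q₀ : G) {Φ : CMF G c} (hΦ : 2 * ddist (rt c Q₀ (arcType hw hk hc2 hwc 0)) Φ ≤ (univ.filter fun n : G => w n = 0).card)
    {b b' : G} (hb : b ∈ (rt c Q₀ (arcType hw hk hc2 hwc 0)).1 \ Φ.1) (hb' : b' ∈ (rt c Q₀ (arcType hw hk hc2 hwc 0)).1 \ Φ.1) (hbb' : b ≠ b')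
    (hf : gface c hc2 Φ b b' ∈ L) :
    Finsupp.single Φ (1 : ℤ) - ((∑ t ∈ (rt c Q₀ (arcType hw hk hc2 hwc 0)).1 \ Φ.1,
      (Finsupp.single (oflipCM c hc2 t (rt c Q₀ (arcType hw hk hc2 hwc 0))) (1 : ℤ) - Finsupp.single (rt c Q₀ (arcType hw hk hc2 hwc 0)) 1)) +
        Finsupp.single (rt c Q₀ (arcType hw hk hc2 hwc 0)) 1) ∈ L := by
  set T := rt c Q₀ (arcType hw hk hc2 hwc 0) with hT
  set E : G → (CMF G c →₀ ℤ) := fun t => Finsupp.single (oflipCM c hc2 t T) (1 : ℤ) - Finsupp.single T 1 with hE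
  -- deviation sets of the three lower corners
  have hdb : T.1 \ (oflipCM c hc2 b Φ).1 = (T.1 \ Φ.1).erase b := dev_oflip c hc2 (mem_sdiff.mp hb).1 (mem_sdiff.mp hb).2
  have hdb' : T.1 \ (oflipCM c hc2 b' Φ).1 = (T.1 \ Φ.1).erase b' := dev_oflip c hc2 (mem_sdiff.mp hb').1 (mem_sdiff.mp hb').2
  have hbm : b ∈ T.1 \ (oflipCM c hc2 b' Φ).1 := by rw [hdb']; exact mem_erase.mpr ⟨hbb', hb⟩
  have hdbb' : T.1 \ (oflipCM c hc2 b (oflipCM c hc2 b' Φ)).1 = ((T.1 \ Φ.1).erase b').erase b := by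
    rw [dev_oflip c hc2 (mem_sdiff.mp hbm).1 (mem_sdiff.mp hbm).2, hdb']
  have hcb : ((T.1 \ Φ.1).erase b).card + 1 = (T.1 \ Φ.1).card := card_erase_add_one hb
  have hcb' : ((T.1 \ Φ.1).erase b').card + 1 = (T.1 \ Φ.1).card := card_erase_add_one hb'
  have hcbb' : (((T.1 \ Φ.1).erase b').erase b).card + 1 = ((T.1 \ Φ.1).erase b').card := card_erase_add_one (mem_erase.mpr ⟨hbb', hb⟩)
  -- the three lower corners are within half a fibre of `T`
  have h₂ : 2 * ddist T (oflipCM c hc2 b (oflipCM c hc2 b' Φ)) < (univ.filter fun n : G => w n = 0).card := by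
    unfold ddist at hΦ ⊢; rw [hdbb']; omega
  have h₃ : 2 * ddist T (oflipCM c hc2 b Φ) < (univ.filter fun n : G => w n = 0).card := by
    unfold ddist at hΦ ⊢; rw [hdb]; omega
  have h₄ : 2 * ddist T (oflipCM c hc2 b' Φ) < (univ.filter fun n : G => w n = 0).card := by
    unfold ddist at hΦ ⊢; rw [hdb']; omega
  have e₂ := single_sub_normalForm_mem_of_toward hw hk hc2 hwc L htw Q₀ _ h₂
  have e₃ := single_sub_normalForm_mem_of_toward hw hk hc2 hwc L htw Q₀ _ h₃
  have e₄ := single_sub_normalForm_mem_of_toward hw hk hc2 hwc L htw Q₀ _ h₄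
  rw [← hT] at e₂ e₃ e₄
  rw [hdbb'] at e₂
  rw [hdb] at e₃
  rw [hdb'] at e₄
  have h := Submodule.add_mem _ (Submodule.add_mem _ (Submodule.sub_mem _ hf e₂) e₃) e₄
  -- bookkeeping: `Σ_D E = E b + Σ_{D∖b} E`, `Σ_{D∖b'} E = E b + Σ_{D∖b'∖b} E`
  have s1 : (∑ t ∈ T.1 \ Φ.1, E t) = E b + ∑ t ∈ (T.1 \ Φ.1).erase b, E t := (add_sum_erase _ _ hb).symm
  have s2 : (∑ t ∈ (T.1 \ Φ.1).erase b', E t) = E b + ∑ t ∈ ((T.1 \ Φ.1).erase b').erase b, E t :=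
    (add_sum_erase _ _ (mem_erase.mpr ⟨hbb', hb⟩)).symm
  rw [s1]
  rw [s2] at h
  convert h using 1
  simp only [gface, hE]
  abel

/-- **THE ALTERNATING-SUM GLUE** (part XVII §4 with the four linearisations as hypotheses): if the face `gface Ψ t t'` lies in `L` and each corner is
linearised in `L` with respect to some arc type (`[corner] − normal form ∈ L`), the alternating sum of the four normal forms lies in `L`. [folklore] -/
theorem alt_normalForm_mem_of_mems (hw : ∀ P Q : G, w (P * Q) = w P + w Q) (hk : 1 ≤ k) (hc2 : c * c = 1) (hwc : w c ≠ 0)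
    (L : Submodule ℤ (CMF G c →₀ ℤ)) {Ψ : CMF G c} {t t' : G} (hf : gface c hc2 Ψ t t' ∈ L) (Q₁ Q₂ Q₃ Q₄ : G)
    (e₁ : Finsupp.single Ψ (1 : ℤ) - ((∑ s ∈ (rt c Q₁ (arcType hw hk hc2 hwc 0)).1 \ Ψ.1,
        (Finsupp.single (oflipCM c hc2 s (rt c Q₁ (arcType hw hk hc2 hwc 0))) (1 : ℤ) - Finsupp.single (rt c Q₁ (arcType hw hk hc2 hwc 0)) 1)) +
          Finsupp.single (rt c Q₁ (arcType hw hk hc2 hwc 0)) 1) ∈ L)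
    (e₂ : Finsupp.single (oflipCM c hc2 t (oflipCM c hc2 t' Ψ)) (1 : ℤ) - ((∑ s ∈ (rt c Q₂ (arcType hw hk hc2 hwc 0)).1 \ (oflipCM c hc2 t (oflipCM c hc2 t' Ψ)).1,
        (Finsupp.single (oflipCM c hc2 s (rt c Q₂ (arcType hw hk hc2 hwc 0))) (1 : ℤ) - Finsupp.single (rt c Q₂ (arcType hw hk hc2 hwc 0)) 1)) +
          Finsupp.single (rt c Q₂ (arcType hw hk hc2 hwc 0)) 1) ∈ L)
    (e₃ : Finsupp.single (oflipCM c hc2 t Ψ) (1 : ℤ) - ((∑ s ∈ (rt c Q₃ (arcType hw hk hc2 hwc 0)).1 \ (oflipCM c hc2 t Ψ).1,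
        (Finsupp.single (oflipCM c hc2 s (rt c Q₃ (arcType hw hk hc2 hwc 0))) (1 : ℤ) - Finsupp.single (rt c Q₃ (arcType hw hk hc2 hwc 0)) 1)) +
          Finsupp.single (rt c Q₃ (arcType hw hk hc2 hwc 0)) 1) ∈ L)
    (e₄ : Finsupp.single (oflipCM c hc2 t' Ψ) (1 : ℤ) - ((∑ s ∈ (rt c Q₄ (arcType hw hk hc2 hwc 0)).1 \ (oflipCM c hc2 t' Ψ).1,
        (Finsupp.single (oflipCM c hc2 s (rt c Q₄ (arcType hw hk hc2 hwc 0))) (1 : ℤ) - Finsupp.single (rt c Q₄ (arcType hw hk hc2 hwc 0)) 1)) +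
          Finsupp.single (rt c Q₄ (arcType hw hk hc2 hwc 0)) 1) ∈ L) :
    (((∑ s ∈ (rt c Q₁ (arcType hw hk hc2 hwc 0)).1 \ Ψ.1,
        (Finsupp.single (oflipCM c hc2 s (rt c Q₁ (arcType hw hk hc2 hwc 0))) (1 : ℤ) - Finsupp.single (rt c Q₁ (arcType hw hk hc2 hwc 0)) 1)) +
          Finsupp.single (rt c Q₁ (arcType hw hk hc2 hwc 0)) 1) +
      ((∑ s ∈ (rt c Q₂ (arcType hw hk hc2 hwc 0)).1 \ (oflipCM c hc2 t (oflipCM c hc2 t' Ψ)).1,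
        (Finsupp.single (oflipCM c hc2 s (rt c Q₂ (arcType hw hk hc2 hwc 0))) (1 : ℤ) - Finsupp.single (rt c Q₂ (arcType hw hk hc2 hwc 0)) 1)) +
          Finsupp.single (rt c Q₂ (arcType hw hk hc2 hwc 0)) 1)) -
      ((∑ s ∈ (rt c Q₃ (arcType hw hk hc2 hwc 0)).1 \ (oflipCM c hc2 t Ψ).1,
        (Finsupp.single (oflipCM c hc2 s (rt c Q₃ (arcType hw hk hc2 hwc 0))) (1 : ℤ) - Finsupp.single (rt c Q₃ (arcType hw hk hc2 hwc 0)) 1)) +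
          Finsupp.single (rt c Q₃ (arcType hw hk hc2 hwc 0)) 1) -
      ((∑ s ∈ (rt c Q₄ (arcType hw hk hc2 hwc 0)).1 \ (oflipCM c hc2 t' Ψ).1,
        (Finsupp.single (oflipCM c hc2 s (rt c Q₄ (arcType hw hk hc2 hwc 0))) (1 : ℤ) - Finsupp.single (rt c Q₄ (arcType hw hk hc2 hwc 0)) 1)) +
          Finsupp.single (rt c Q₄ (arcType hw hk hc2 hwc 0)) 1) ∈ L := by
  have h := Submodule.sub_mem _ (Submodule.sub_mem _ hf (Submodule.add_mem _ e₁ e₂)) (Submodule.neg_mem _ (Submodule.add_mem _ e₃ e₄))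
  convert h using 1
  simp only [gface]
  abel

end

end Summit.HodgeConjecture.CorCM.Census.CyclicCharacter
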